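import Mathlib.Geometry.Manifold.Instances.Real
import Mathlib.Geometry.Manifold.Diffeomorph
import Mathlib.Geometry.Manifold.IsManifold.InteriorBoundary
import Literature.Topology.FourManifolds.Morse
import Literature.Topology.FourManifolds.Handles
import Literature.Topology.FourManifolds.Gluing
import Literature.Topology.FourManifolds.Cobordism
import Literature.Topology.FourManifolds.SmoothOrientation
import HarnessLib

-- provenance: harness21/H21/H21/Statements/SPC4/Handles.lean @ 9db22bc (interim HEAD d8f2665); M5 mechanical rewrite
/-!
# SPC4: handle decompositions and Kirby diagrams up to 3- and 4-handles (statement **spc4.S24**)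

Family SPC4 (smooth Poincaré conjecture in dimension four and its satellites), trunk FourManL,
notions `kirby_calculus_handles` (layer (a)), `gluing_along_boundary`,
`manifold_boundary_as_manifold`.  Outline: `H21/Outlines/FourManL.md`, §3, file
`Statements/SPC4/Handles.lean`.

Informal statement **spc4.S24** (known theorem): *every compact smooth manifold admits a handle
decomposition; closed smooth 4-manifolds are described by Kirby diagrams up to 3- and 4-handles*
(Smale 1962; Milnor 1963; Laudenbach–Poenaru 1972; Gompf–Stipsicz 1999, §4).

We give three faithful forms.

* (a) **Existence of handle decompositions.**  `exists_isMorseAdapted`: every compact smooth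
  manifold with boundary `W` carries a Morse function adapted to `∂W` (Morse 1934; Milnor 1963,
  Cor. 6.7, plus a collar of the boundary), which by the Morse-theoretic definition of the prelude
  (`Literature.Topology.FourManifolds.HasHandleDecomposition`, `Literature.Topology.FourManifolds.IsHandleAttachment`; Milnor 1963, Thm. 3.2) *is* a handle
  decomposition; `exists_isMorse`: the closed case; `exists_handleChain`: the iterated form
  `∅ = W₀ ⊂ W₁ ⊂ ⋯ ⊂ Wₘ ≅ W`, each `Wᵢ₊₁` obtained from `Wᵢ` by attaching one handle
  (Smale 1962; Milnor 1965, §2, Cor. 2.10 with §3, Def. 3.10 and Thm. 3.13).  **Erratum /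
  retired predicate:** as formalised, the dimension-parametrised predicate `exists_handleChain n`
  is *refuted* at `n = 0` (`Literature.Topology.FourManifolds.not_exists_handleChain_zero`,
  `SPC4HandleChainProofs.lean`) and *proved* for all `n ≥ 1`
  (`Literature.Topology.FourManifolds.exists_handleChain_succ_holds`, `SPC4MorseExistence.lean`;
  decided form `Literature.Topology.FourManifolds.exists_handleChain_iff_one_le`), so its closed
  reading `∀ n, exists_handleChain n` is false: it is **no longer a registered named fact**
  (verdict clean-up 2026-08-15) and is kept, body verbatim, only as a deprecated predicate for
  those in-tree theorems; see its docstring.  The corrected (closed) statement is the named fact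
  `exists_handleChain_of_one_le`, §(a′) below, discharged by
  `Literature.Topology.FourManifolds.exists_handleChain_of_one_le_holds`
  (`SPC4HandleChainOneLeProofs.lean`).
* (b) **Nice handle decompositions.**  `exists_isMorse_isSelfIndexing`: a closed connected smooth
  `n`-manifold carries a self-indexing Morse function with exactly one critical point of index `0`
  and one of index `n` (Smale 1961, "nice functions"; Milnor 1965, Thm. 4.8 and §8), i.e. a handle
  decomposition with handles attached in order of increasing index, one `0`-handle and one
  `n`-handle.
* (c) **Dimension four: up to 3- and 4-handles.**  `exists_diffeomorph_comp_incl_eq`: every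
  self-diffeomorphism of the boundary `#k S¹ × S²` of a compact connected orientable
  4-dimensional 1-handlebody `V ≅ ♮k S¹ × B³` extends over `V` (Laudenbach–Poenaru 1972); and its
  corollary `nonempty_diffeomorph_of_isBoundaryGluing_twoHandlebody`: a closed smooth 4-manifold
  is determined up to diffeomorphism by its 2-handlebody (the union of its `0`-, `1`- and
  `2`-handles), since the union of the `3`- and `4`-handles is `♮k S¹ × B³` (turned upside down, a
  1-handlebody) and any gluing map extends (Gompf–Stipsicz 1999, §4.4).

Together (a)–(c) are the formal content of "closed smooth 4-manifolds are described by Kirby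
diagrams up to 3- and 4-handles": by (a)/(b) a closed smooth 4-manifold `M` is a handlebody with one
`0`-handle, and cutting after the `2`-handles writes `M = W ∪_φ V` with `W` a 2-handlebody and `V`
a 1-handlebody of the dual decomposition; a *Kirby diagram* is precisely the attaching data of the
2-handlebody `W` (dotted circles for the `1`-handles and a framed link in `S³ = ∂D⁴` for the
`2`-handles — the framed-link calculus is the prelude file `KirbyMoves`), and by (c) `W` alone
determines `M`.  Kirby diagrams themselves are not built here; the 2-handlebody enters abstractly
through `Literature.IsHandlebodyOfIndexLE 3 2 W`.

## Mathlib status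

Mathlib (pinned commit) has smooth manifolds with boundary (`𝓡∂ n`, `ModelWithCorners.boundary`),
diffeomorphisms (`Diffeomorph`, `≃ₘ⟮I, J⟯`) and smooth embeddings, but no Morse functions, handles,
handlebodies, Kirby diagrams or gluing along boundaries (grep for `Morse`, `handlebody`, `Kirby`
finds only `Mathlib/Geometry/Manifold/PoincareConjecture.lean`-style statements and Morse-code
unrelated hits).  All notions used come from the accepted H21 prelude files
`FourManL/Morse.lean` (`IsMorse`, `IsMorseAdapted`, `IsSelfIndexing`, `criticalSetOfIndex`),
`FourManL/Handles.lean` (`IsHandleAttachment`, `IsHandlebodyOfIndexLE`),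
`FourManL/Gluing.lean` (`IsBoundaryGluing`), `FourManM/Cobordism.lean` (`BoundaryData`) and
`FourManM/SmoothOrientation.lean` (`IsOrientable`).

## Design notes

* In (c) the gluing maps `φ`, `φ'` are taken to be diffeomorphisms of the boundary 3-manifolds
  (`≃ₘ⟮𝓡 3, 𝓡 3⟯`), as in the prelude's `Literature.Topology.FourManifolds.nonempty_diffeomorph_of_isBoundaryGluing`; this is
  the literal hypothesis of Gompf–Stipsicz §4.4.
* `IsOrientable (𝓡∂ 4) V` needs `IsManifold (𝓡∂ 4) 1 V`, which is inferred from
  `IsManifold (𝓡∂ 4) ∞ V`.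
* Counting critical points uses `Set.ncard`, as in the prelude (`HasHandleDecomposition`, Reeb's
  theorem); on a compact manifold the critical set of a Morse function is finite
  (`IsMorse.finite_criticalSet`), so the junk value `0` does not interfere with the value `1`.

## References

* M. Morse, *The calculus of variations in the large*, AMS Colloquium Publ. 18 (1934).
* S. Smale, *On gradient dynamical systems*, Ann. of Math. 74 (1961), Thm. A ("nice functions").
* S. Smale, *On the structure of manifolds*, Amer. J. Math. 84 (1962).
* J. Milnor, *Morse theory*, Ann. of Math. Studies 51 (1963), §3 and Cor. 6.7.
* J. Milnor, *Lectures on the h-cobordism theorem*, Princeton (1965), §2 (Thm. 2.5, Lemmas 2.8–2.9,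
  Cor. 2.10), §§3–4, §8.
* F. Laudenbach, V. Poénaru, *A note on 4-dimensional handlebodies*, Bull. SMF 100 (1972),
  337–344.
* R. Gompf, A. Stipsicz, *4-manifolds and Kirby calculus*, GSM 20, AMS (1999), §4.2, §4.4.
-/

open scoped Manifold ContDiff
open Set Function

noncomputable section

namespace Literature.Topology.FourManifolds

section SPC4

universe u

/-- Local notation: `𝔼 n` is the model Euclidean space `EuclideanSpace ℝ (Fin n)`. -/
local notation "𝔼 " n:arg => EuclideanSpace ℝ (Fin n)

/-! ### (a) Existence of handle decompositions -/

section Existence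

variable (n : ℕ)

/-- **spc4.S24** (existence of handle decompositions, Morse-function form; Morse 1934; Milnor,
*Morse theory* (1963), Cor. 6.7 with a collar of the boundary; Milnor, *Lectures on the
h-cobordism theorem* (1965), Thm. 2.5).  Every compact smooth `(n+1)`-manifold with boundary `W`
carries a Morse function adapted to its boundary (`f ≡ 1` and regular on `∂W`, `f < 1` inside);
by Milnor (1963), Thm. 3.2, this presents `W` as a handlebody built on `∅`, i.e. `W` admits a
handle decomposition (cf. `Literature.Topology.FourManifolds.hasHandleDecomposition_of_isMorseAdapted`). [cite: Morse1934] -/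
def exists_isMorseAdapted : Prop :=
  ∀ (W : Type u) [TopologicalSpace W] [T2Space W] [SecondCountableTopology W] [CompactSpace W] [ChartedSpace (EuclideanHalfSpace (n + 1)) W] [IsManifold (𝓡∂ (n + 1)) ∞ W],
    ∃ f : W → ℝ, IsMorseAdapted (𝓡∂ (n + 1)) f

/-- **spc4.S24** (existence of Morse functions on closed manifolds; Morse 1934; Milnor, *Morse
theory* (1963), Cor. 6.7: on a compact manifold Morse functions exist, indeed are dense).  Every
closed smooth `n`-manifold carries a Morse function, hence (Milnor 1963, Thms. 3.1–3.2, 3.5) a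
handle decomposition / CW structure with one `k`-cell per critical point of index `k`. [cite: Milnor1963, Thms. 3.1–3.2  3.5] -/
def exists_isMorse : Prop :=
  ∀ (M : Type u) [TopologicalSpace M] [T2Space M] [SecondCountableTopology M] [CompactSpace M] [ChartedSpace (𝔼 n) M] [IsManifold (𝓡 n) ∞ M],
    ∃ f : M → ℝ, IsMorse (𝓡 n) f

/-- **Deprecated — retired from the named-fact register (verdict clean-up, 2026-08-15): use the
closed, discharged named fact `Literature.Topology.FourManifolds.exists_handleChain_of_one_le`
(§(a′) below; proof `Literature.Topology.FourManifolds.exists_handleChain_of_one_le_holds`).**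

`exists_handleChain : ℕ → Prop` is a *dimension-parametrised predicate*, kept with its body
verbatim because the in-tree theorems deciding it are stated in terms of it; it is **not** a
named fact — its only closed reading, `∀ n, exists_handleChain n`, is false.  Decided status
(all sorry-free, in sibling files importing this one):
* **refuted at `n = 0`**: `Literature.Topology.FourManifolds.not_exists_handleChain_zero :
  ¬ exists_handleChain.{0} 0` (`SPC4HandleChainProofs.lean`) — the refuting theorem of record;
* **proved at every `n ≥ 1`**: `Literature.Topology.FourManifolds.exists_handleChain_succ_holds
  (n : ℕ) : exists_handleChain (n + 1)` (`SPC4MorseExistence.lean`; Milnor 1965, Thm. 2.5,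
  Lemmas 2.8–2.9, Cor. 2.10), whence
  `Literature.Topology.FourManifolds.exists_handleChain_iff_one_le (n : ℕ) :
  exists_handleChain.{0} n ↔ 1 ≤ n` (`SPC4HandleChainOneLeProofs.lean`);
* **corrected closed statement**: `exists_handleChain_of_one_le` — this very body under the one
  extra hypothesis `1 ≤ n` (`exists_handleChain_of_one_le_iff :
  exists_handleChain_of_one_le ↔ ∀ n ≥ 1, exists_handleChain n`, by `Iff.rfl`), discharged by
  `exists_handleChain_of_one_le_holds`.  A consumer wanting handle chains of compact
  `4`-manifolds uses `exists_handleChain_of_one_le_holds 3 (by norm_num)` (or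
  `exists_handleChain_succ_holds 2`).

**The predicate** (existence of handle decompositions, handle-chain form — **spc4.S24 (a)**;
informal sources: Smale, *On the structure of manifolds* (1962); Milnor, *Lectures on the
h-cobordism theorem* (1965), §2, Cor. 2.10, "Any cobordism can be expressed as a composition of
cobordisms with Morse number 1" (p. 11 of the held copy), with `V₀ = ∅`, together with §3,
Def. 3.10 (an elementary cobordism is a triad possessing a Morse function with exactly one
critical point, p. 16) and Thm. 3.13 (an elementary cobordism of index `λ` is `ω(V, φ_L)`, i.e.
`V × [0,1]` with a `λ`-handle attached, p. 18); Kosinski, *Differential Manifolds* (1993),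
VII.1.1).  `exists_handleChain n` says: every compact smooth `(n+1)`-manifold with boundary `W`
is diffeomorphic to the last term of a finite chain `∅ = W₀, W₁, …, Wₘ` of compact smooth
`(n+1)`-manifolds with boundary in which each `Wᵢ₊₁` is obtained from `Wᵢ` by attaching a
single handle of some index `k ≤ n + 1`
(`Literature.Topology.FourManifolds.IsHandleAttachment n k Wᵢ Wᵢ₊₁`).

**What was wrong** (named-fact programme, `provefact-Literature.SPC4.exists_handleChain`).
Milnor's corollary is dimension-free and true; the defect lies in the encoding of "`W'` is `W`
with one handle attached" through `Manifold.IsSmoothEmbedding` (slice charts with a *linear*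
model map): in dimension one every chart of the maximal atlas sends a boundary point of the
smaller manifold to the boundary value `0 ∈ EuclideanHalfSpace 1`, so no compact `1`-manifold
with nonempty boundary is smoothly embedded, in this sense, into the interior of another; a
chain of `1`-manifolds then has at most one handle, and `[0,1] ⊔ [0,1]`, which is not a single
handle on `∅`, ends no chain.  From dimension two on the slice chart can be translated and
tilted and the encoding is sound, so the statement is unchanged — and proved — in every
dimension `≥ 2`, in particular for compact `4`-manifolds (`n = 3`).  (*Locator note*: early
versions of this docstring cited Milnor 1965, "§3, Cor. 3.15"; that corollary is the homology
computation `H_*(W, V) ≅ ℤ` of an elementary cobordism, not the chain statement, which is §2,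
Cor. 2.10.)  The Lean `deprecated` attribute is deliberately not attached: the only in-tree
users are the theorems above that decide the predicate, where it would merely raise
`linter.deprecated` warnings.  The provenance tag below records the source of the *statement
form* only (every declaration carries one); the predicate's truth value is the in-tree theorem
`exists_handleChain_iff_one_le`, not a citation.
[cite: MilnorHCobordism1965, §2 Cor. 2.10 (V₀ = ∅) with §3 Def. 3.10 and Thm. 3.13 — statement form of a retired predicate, decided in-tree] -/
def exists_handleChain (n : ℕ) : Prop :=
  ∀ (W : Type u) [TopologicalSpace W] [T2Space W] [SecondCountableTopology W] [CompactSpace W] [ChartedSpace (EuclideanHalfSpace (n + 1)) W] [IsManifold (𝓡∂ (n + 1)) ∞ W],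
    ∃ (m : ℕ) (Ws : Fin (m + 1) → Type u) (_ : ∀ i, TopologicalSpace (Ws i))
      (_ : ∀ i, T2Space (Ws i)) (_ : ∀ i, SecondCountableTopology (Ws i))
      (_ : ∀ i, CompactSpace (Ws i)) (_ : ∀ i, ChartedSpace (EuclideanHalfSpace (n + 1)) (Ws i))
      (_ : ∀ i, IsManifold (𝓡∂ (n + 1)) ∞ (Ws i)),
      IsEmpty (Ws 0) ∧ Nonempty (Ws (Fin.last m) ≃ₘ⟮𝓡∂ (n + 1), 𝓡∂ (n + 1)⟯ W) ∧
      ∀ i : Fin m, ∃ k ≤ n + 1, IsHandleAttachment n k (Ws i.castSucc) (Ws i.succ)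

/-! ### (b) Nice (self-indexing) Morse functions -/

/-- **spc4.S24** (nice handle decompositions; Smale, *On gradient dynamical systems* (1961),
Thm. A "nice functions"; Milnor, *Lectures on the h-cobordism theorem* (1965), Thm. 4.8
(rearrangement) and Thm. 8.1 (cancellation of superfluous `0`- and `n`-handles on a connected
manifold)).  Every (nonempty) closed connected smooth `n`-manifold carries a *self-indexing*
Morse function (`f (p) = index p` at every critical point `p`) with exactly one critical point of
index `0` and exactly one of index `n`: a handle decomposition with the handles attached in order
of increasing index, a single `0`-handle and a single `n`-handle.  (`ConnectedSpace M` entails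
`Nonempty M` in Mathlib.) [cite: MilnorHCobordism1965, Thm. 4.8 and §8 (self-indexing; one critical point of index 0 and n)] -/
def exists_isMorse_isSelfIndexing : Prop :=
  ∀ (M : Type u) [TopologicalSpace M] [T2Space M] [SecondCountableTopology M] [CompactSpace M] [ConnectedSpace M] [ChartedSpace (𝔼 n) M] [IsManifold (𝓡 n) ∞ M],
    ∃ f : M → ℝ, IsMorse (𝓡 n) f ∧ IsSelfIndexing (𝓡 n) f ∧
      (criticalSetOfIndex (𝓡 n) f 0).ncard = 1 ∧ (criticalSetOfIndex (𝓡 n) f n).ncard = 1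

end Existence

/-! ### (c) Dimension four: closed 4-manifolds up to 3- and 4-handles -/

section DimFour

/-- **spc4.S24** (Laudenbach–Poénaru extension theorem; F. Laudenbach, V. Poénaru, *A note on
4-dimensional handlebodies*, Bull. SMF 100 (1972); Gompf–Stipsicz, *4-manifolds and Kirby
calculus* (1999), §4.4).  Let `V` be a compact connected orientable smooth 4-manifold with
boundary which is a 1-handlebody (handles of index `≤ 1` only), so that `V ≅ ♮k S¹ × B³` and
`∂V ≅ #k S¹ × S²`.  Then every self-diffeomorphism `φ` of the boundary `∂V` (packaged as a
`BoundaryData` `b`, with inclusion `b.incl : ∂V ↪ V`) extends to a self-diffeomorphism `Φ` of `V`: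
`Φ ∘ incl = incl ∘ φ`.  This is why 3- and 4-handles of a closed 4-manifold need not be drawn in a
Kirby diagram. [cite: LaudenbachPoenaruBSMF1972, main theorem] -/
def exists_diffeomorph_comp_incl_eq : Prop :=
  ∀ (V : Type u) [TopologicalSpace V] [T2Space V] [SecondCountableTopology V] [CompactSpace V] [ConnectedSpace V] [ChartedSpace (EuclideanHalfSpace 4) V] [IsManifold (𝓡∂ 4) ∞ V] (hV : IsHandlebodyOfIndexLE 3 1 V) (ho : IsOrientable (𝓡∂ 4) V) (b : BoundaryData (𝓡∂ 4) V (𝓡 3)) (φ : b.carrier ≃ₘ⟮𝓡 3, 𝓡 3⟯ b.carrier),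
    ∃ Φ : V ≃ₘ⟮𝓡∂ 4, 𝓡∂ 4⟯ V, ⇑Φ ∘ b.incl = b.incl ∘ ⇑φ

/-- **spc4.S24** (a closed smooth 4-manifold is determined by its 2-handlebody: "Kirby diagrams
describe closed 4-manifolds up to 3- and 4-handles"; Gompf–Stipsicz, *4-manifolds and Kirby
calculus* (1999), §4.4, from Laudenbach–Poénaru (1972)).
Let `M = W ∪_φ V` and `M' = W ∪_{φ'} V'` be closed smooth 4-manifolds, each obtained by gluing
the same compact 2-handlebody `W` (handles of index `≤ 2`) along its boundary to a compact
connected orientable 1-handlebody (`V`, resp. `V'`; these are the `3`- and `4`-handles of `M`,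
`M'` turned upside down, `≅ ♮k S¹ × B³`) by boundary diffeomorphisms `φ : ∂W ≅ ∂V`,
`φ' : ∂W ≅ ∂V'`.  Then `M ≅ M'`: `∂V ≅ ∂W ≅ ∂V'` forces `V ≅ V'`, and the resulting
self-diffeomorphism of `∂V'` extends over `V'` by `exists_diffeomorph_comp_incl_eq`; conclude with
uniqueness of gluings (`Literature.Topology.FourManifolds.nonempty_diffeomorph_of_isBoundaryGluing`).  Combined with
`exists_isMorse_isSelfIndexing` (every closed connected 4-manifold splits as such a `W ∪_φ V`),
this is the formal content of the second half of **spc4.S24**; the Kirby diagram is the attaching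
data of `W` (see the prelude file `KirbyMoves` for its framed-link part). [cite: LaudenbachPoenaru1972] -/
def nonempty_diffeomorph_of_isBoundaryGluing_twoHandlebody : Prop :=
  ∀ (M M' : Type u) [TopologicalSpace M] [T2Space M] [SecondCountableTopology M] [CompactSpace M] [ChartedSpace (𝔼 4) M] [IsManifold (𝓡 4) ∞ M] [TopologicalSpace M'] [T2Space M'] [SecondCountableTopology M'] [CompactSpace M'] [ChartedSpace (𝔼 4) M'] [IsManifold (𝓡 4) ∞ M'] (W V V' : Type u) [TopologicalSpace W] [T2Space W] [SecondCountableTopology W] [CompactSpace W] [ChartedSpace (EuclideanHalfSpace 4) W] [IsManifold (𝓡∂ 4) ∞ W] [TopologicalSpace V] [T2Space V] [SecondCountableTopology V] [CompactSpace V] [ConnectedSpace V] [ChartedSpace (EuclideanHalfSpace 4) V] [IsManifold (𝓡∂ 4) ∞ V] [TopologicalSpace V'] [T2Space V'] [SecondCountableTopology V'] [CompactSpace V'] [ConnectedSpace V'] [ChartedSpace (EuclideanHalfSpace 4) V'] [IsManifold (𝓡∂ 4) ∞ V'] (hW : IsHandlebodyOfIndexLE 3 2 W) (hV : IsHandlebodyOfIndexLE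 3 1 V) (hV' : IsHandlebodyOfIndexLE 3 1 V') (hoV : IsOrientable (𝓡∂ 4) V) (hoV' : IsOrientable (𝓡∂ 4) V') (bW : BoundaryData (𝓡∂ 4) W (𝓡 3)) (bV : BoundaryData (𝓡∂ 4) V (𝓡 3)) (bV' : BoundaryData (𝓡∂ 4) V' (𝓡 3)) (φ : bW.carrier ≃ₘ⟮𝓡 3, 𝓡 3⟯ bV.carrier) (φ' : bW.carrier ≃ₘ⟮𝓡 3, 𝓡 3⟯ bV'.carrier) (hM : IsBoundaryGluing bW bV φ (𝓡 4) M) (hM' : IsBoundaryGluing bW bV' φ' (𝓡 4) M'),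
    Nonempty (M ≃ₘ⟮𝓡 4, 𝓡 4⟯ M')

end DimFour

/-! ### (a′) Handle chains in dimension `≥ 2`: the corrected statement of `exists_handleChain` -/

section Corrected

/-- **spc4.S24 (a), corrected statement of `exists_handleChain`** (existence of handle
decompositions, handle-chain form, in dimension `n + 1 ≥ 2`; Smale, *On the structure of
manifolds* (1962); Milnor, *Lectures on the h-cobordism theorem* (1965), §2, Cor. 2.10 — "Any
cobordism can be expressed as a composition of cobordisms with Morse number 1" (p. 11 of the
held copy) — with `V₀ = ∅`, together with §3, Def. 3.10 (an elementary cobordism is a triad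
possessing a Morse function with exactly one critical point, p. 16) and Thm. 3.13 (an
elementary cobordism of index `λ` is `ω(V, φ_L)`, i.e. `V × [0,1]` with a `λ`-handle attached,
p. 18); Kosinski, *Differential Manifolds* (1993), VII.1.1).  For every `n ≥ 1`, every compact
smooth `(n+1)`-manifold with boundary `W` is diffeomorphic to the last term of a finite chain
`∅ = W₀, W₁, …, Wₘ` of compact smooth `(n+1)`-manifolds with boundary in which each `Wᵢ₊₁` is
obtained from `Wᵢ` by attaching a single handle of some index `k ≤ n + 1`
(`Literature.Topology.FourManifolds.IsHandleAttachment n k Wᵢ Wᵢ₊₁`).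

**Relation to `exists_handleChain` (the discrepancy).**  The body below is *verbatim* that of
the dimension-parametrised predicate `exists_handleChain n` of §(a) (a former named fact, retired
from the fact register in favour of the present statement), under the single extra hypothesis
`1 ≤ n`; `exists_handleChain_of_one_le_iff` records
`exists_handleChain_of_one_le ↔ ∀ n ≥ 1, exists_handleChain n` by `Iff.rfl`.  A corrected
statement is needed because `exists_handleChain n` is *refuted* at `n = 0`
(`Literature.Topology.FourManifolds.not_exists_handleChain_zero : ¬ exists_handleChain.{0} 0`,
`SPC4HandleChainProofs.lean`) and *proved* at every `n ≥ 1`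
(`Literature.Topology.FourManifolds.exists_handleChain_succ_holds`, `SPC4MorseExistence.lean`,
following Milnor's Thm. 2.5, Lemmas 2.8–2.9 and Cor. 2.10): its universal closure
`∀ n, exists_handleChain n` — the only closed reading of a parametrised fact — is false and has
no discharge, although Milnor's corollary is dimension-free and true.  The defect lies not in
the source but in the encoding of "`W'` is `W` with one handle attached" through
`Manifold.IsSmoothEmbedding` (slice charts with a *linear* model map): in dimension one every
chart of the maximal atlas sends a boundary point of the smaller manifold to the boundary value
`0 ∈ EuclideanHalfSpace 1`, so no compact `1`-manifold with nonempty boundary is smoothly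
embedded, in this sense, into the interior of another; a chain of `1`-manifolds then has at
most one handle and `[0,1] ⊔ [0,1]` ends no chain.  From dimension two on the slice chart can be
translated and tilted and the encoding is sound.  Restricting to `n ≥ 1` is therefore the
faithful rendering of Cor. 2.10 (`V₀ = ∅`) within this encoding — the statement is unchanged in
every dimension `≥ 2`, in particular for compact `4`-manifolds (`n = 3`) — and the old `def` is
kept verbatim.  Discharge: `exists_handleChain_of_one_le_holds`, from
`exists_handleChain_succ_holds` (sibling proofs file).
[cite: MilnorHCobordism1965, §2 Cor. 2.10 (V₀ = ∅) with §3 Def. 3.10 and Thm. 3.13] -/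
def exists_handleChain_of_one_le : Prop :=
  ∀ (n : ℕ), 1 ≤ n → ∀ (W : Type u) [TopologicalSpace W] [T2Space W] [SecondCountableTopology W] [CompactSpace W] [ChartedSpace (EuclideanHalfSpace (n + 1)) W] [IsManifold (𝓡∂ (n + 1)) ∞ W],
    ∃ (m : ℕ) (Ws : Fin (m + 1) → Type u) (_ : ∀ i, TopologicalSpace (Ws i))
      (_ : ∀ i, T2Space (Ws i)) (_ : ∀ i, SecondCountableTopology (Ws i))
      (_ : ∀ i, CompactSpace (Ws i)) (_ : ∀ i, ChartedSpace (EuclideanHalfSpace (n + 1)) (Ws i))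
      (_ : ∀ i, IsManifold (𝓡∂ (n + 1)) ∞ (Ws i)),
      IsEmpty (Ws 0) ∧ Nonempty (Ws (Fin.last m) ≃ₘ⟮𝓡∂ (n + 1), 𝓡∂ (n + 1)⟯ W) ∧
      ∀ i : Fin m, ∃ k ≤ n + 1, IsHandleAttachment n k (Ws i.castSucc) (Ws i.succ)

/-- The corrected fact `exists_handleChain_of_one_le` is, definitionally, the conjunction over
all `n ≥ 1` of the instances `exists_handleChain n` of the (retired, dimension-parametrised)
predicate of §(a) (same body), so
a user holding `(h : exists_handleChain (n + 1))` is fed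
`exists_handleChain_of_one_le_iff.mp h' (n + 1) n.succ_pos` without change of meaning. [folklore] -/
theorem exists_handleChain_of_one_le_iff :
    exists_handleChain_of_one_le.{u} ↔ ∀ n : ℕ, 1 ≤ n → exists_handleChain.{u} n :=
  Iff.rfl

end Corrected

end SPC4

end Literature.Topology.FourManifolds
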